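import Summits.HubbardSuperconductivity.HubbardSuperconductivity.Theorems.AnisotropyChordInsertionEntropyJastrow
import Summits.HubbardSuperconductivity.HubbardSuperconductivity.Theorems.AnisotropyChordInsertionEntropyLatticeSum

/-!
# Route `AnisotropyChord` / H0 rotor rung: the JELLIUM-SHEET Jastrow state — conjecture R8
# `JelliumSheetEntropyBound` and its PROVED reduction to classical two-defect screening
# (theory seat `hubbard-h0-rotor-theory-1`, cycle 9, memo ROTOR-THEORY-9 §135(b)–(f); Sketch9 Part G ported)

The Rokhsar–Kivelson state `ψ = jastrowAmp (sheetKernel L β c)` of hard-core bosons on `(ℤ/L)²` with the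
3D-Coulomb pair potential `β/d(u,v)` (`d` = torus distance) — the `(S)∧(K)` regime `S(k) ≍ |k|` of the rotor
class in Jastrow form:
* `sheetKernel`, `sheetFun` (difference-kernel form), symmetry / reflection lemmas, `pairMass_symm_sheet`
  (`a_{yx} = a_{xy}` by `z ↦ x + y − z`), `klDiv_teleLaw_sheet'` (J2 unconditionally);
* **CONJECTURE R8** `JelliumSheetEntropyBound β c` (OPEN) and `jelliumSheetEntropyBound_iff` : R8 ⟺ bounded mean
  spectator-potential difference between a pinned vacancy and a pinned particle (PROVED equivalence);
* `klDiv_teleLaw_sheet_cloud` (J3′ for the sheet), **R8a** `SheetWeightedScreening` and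
  `jelliumSheetEntropyBound_of_weightedScreening` : R8a ⇒ R8 (PROVED).
Numerics (kit j302905/j302941, HOME cycle9/RIESZ-TABLE.md): perfect screening law `KL(r) = κ − w(r) ± 0.002`.
Nothing here claims R8.
-/

set_option linter.dupNamespace false

noncomputable section

open Finset
open Literature.Probability.LatticeModels

namespace Summit.HubbardSuperconductivity.HubbardSuperconductivity.Theorems.AnisotropyChord.InsertionEntropy

section JelliumSheet

/-- The sheet kernel as a difference kernel: `c` at `0`, `β / d(v)` otherwise, `d(v) = (L/2π)·|v|_T` the lattice
torus distance. (theory seat `hubbard-h0-rotor-theory-1`, memo ROTOR-THEORY-9 §135) [folklore] -/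
def sheetFun (L : ℕ) [NeZero L] (β c : ℝ) (v : TorusSite 2 L) : ℝ :=
  if v = 0 then c else β / ((L : ℝ) / (2 * Real.pi) * torusNorm L v)

/-- The JELLIUM-SHEET kernel on the discrete torus `(ℤ/L)²`: 3D-Coulomb `β/d(u,v)` between distinct sites, `d` =
lattice torus distance `= (L/2π)·|u−v|_T` (the tree's `torusNorm` is the reduced wave number `(2π/L)·d`); the diagonal
carries the chemical-potential constant `c`. (theory seat `hubbard-h0-rotor-theory-1`, memo ROTOR-THEORY-9 §135) [folklore] -/
def sheetKernel (L : ℕ) [NeZero L] (β c : ℝ) (u v : TorusSite 2 L) : ℝ :=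
  if u = v then c else β / ((L : ℝ) / (2 * Real.pi) * torusNorm L (u - v))

/-- `|−k|_T = |k|_T`. [folklore] -/
theorem torusNorm_neg (L : ℕ) [NeZero L] (k : TorusSite 2 L) : torusNorm L (-k) = torusNorm L k := by
  have h : ∀ i, min ((-k) i).val (L - ((-k) i).val) = min (k i).val (L - (k i).val) := by
    intro i
    rw [Pi.neg_apply, ZMod.neg_val]
    split_ifs with h0
    · simp [h0]
    · rw [Nat.sub_sub_self (ZMod.val_lt (k i)).le, min_comm]
  unfold torusNorm
  simp only [h]

/-- The sheet kernel is symmetric. [folklore] -/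
theorem sheetKernel_symm (L : ℕ) [NeZero L] (β c : ℝ) (u v : TorusSite 2 L) :
    sheetKernel L β c u v = sheetKernel L β c v u := by
  unfold sheetKernel
  by_cases h : u = v
  · subst h; rfl
  · rw [if_neg h, if_neg (Ne.symm h), ← neg_sub u v, torusNorm_neg]

/-- The sheet kernel has a constant diagonal. [folklore] -/
theorem sheetKernel_diag (L : ℕ) [NeZero L] (β c : ℝ) (u v : TorusSite 2 L) :
    sheetKernel L β c u u = sheetKernel L β c v v := by
  simp [sheetKernel]

/-- J2 for the jellium sheet: `KL(ν_x^{(y)} ‖ ν_y^{(x)}) = E[Φ_τ(y) − Φ_τ(x) | x occupied, y empty]` with the 3D-Coulomb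
spectator potential (pair-mass symmetry kept as a hypothesis; discharged below). [folklore] -/
theorem klDiv_teleLaw_sheet (L : ℕ) [NeZero L] (β c : ℝ) (x y : TorusSite 2 L)
    (hm : pairMass (jastrowAmp (sheetKernel L β c)) y x = pairMass (jastrowAmp (sheetKernel L β c)) x y) :
    klDiv (teleLaw (jastrowAmp (sheetKernel L β c)) x y) (teleLaw (jastrowAmp (sheetKernel L β c)) y x)
      = ∑ τ, teleLaw (jastrowAmp (sheetKernel L β c)) x y τ *
          (spectatorField (sheetKernel L β c) τ y - spectatorField (sheetKernel L β c) τ x) :=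
  klDiv_teleLaw_jastrow _ (sheetKernel_symm L β c) x y (sheetKernel_diag L β c x y) hm

/-- The sheet kernel is invariant under the point reflection `z ↦ x + y − z`. [folklore] -/
theorem sheetKernel_reflect (L : ℕ) [NeZero L] (β c : ℝ) (x y u v : TorusSite 2 L) :
    sheetKernel L β c ((x + y) - u) ((x + y) - v) = sheetKernel L β c u v := by
  unfold sheetKernel
  have h2 : (x + y - u) - (x + y - v) = -(u - v) := by abel
  simp only [sub_right_inj, h2, torusNorm_neg]

/-- `a_{yx} = a_{xy}` for the jellium-sheet Jastrow state (reflection `z ↦ x + y − z`). [folklore] -/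
theorem pairMass_symm_sheet (L : ℕ) [NeZero L] (β c : ℝ) (x y : TorusSite 2 L) :
    pairMass (jastrowAmp (sheetKernel L β c)) y x = pairMass (jastrowAmp (sheetKernel L β c)) x y :=
  pairMass_symm_of_reflection _ x y (Equiv.subLeft (x + y)) (by simp [Equiv.subLeft_apply])
    (by simp [Equiv.subLeft_apply])
    (fun u v => by simp only [Equiv.subLeft_apply]; exact sheetKernel_reflect L β c x y u v)

/-- J2 for the jellium sheet, unconditionally. Theory seat memo ROTOR-THEORY-9 §135. [folklore] -/
theorem klDiv_teleLaw_sheet' (L : ℕ) [NeZero L] (β c : ℝ) (x y : TorusSite 2 L) :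
    klDiv (teleLaw (jastrowAmp (sheetKernel L β c)) x y) (teleLaw (jastrowAmp (sheetKernel L β c)) y x)
      = ∑ τ, teleLaw (jastrowAmp (sheetKernel L β c)) x y τ *
          (spectatorField (sheetKernel L β c) τ y - spectatorField (sheetKernel L β c) τ x) :=
  klDiv_teleLaw_sheet L β c x y (pairMass_symm_sheet L β c x y)

/-- **CONJECTURE R8 — `JelliumSheetEntropyBound` (Debye screening of the jellium sheet ⇒ bounded teleportation entropy;
OPEN).**  For small `β > 0` and a chemical potential `c`, the Jastrow/RK ground state `ψ = jastrowAmp (sheetKernel L β c)`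
of hard-core bosons on `(ℤ/L)²` has teleportation relative entropies bounded uniformly in `L` and in the pair of sites.  By
J2 (`klDiv_teleLaw_jastrow`) this is the statement that the classical lattice gas with 3D-Coulomb pair potential on a 2D
sheet, conditioned on one pinned particle and one pinned vacancy, shifts the mean spectator potential between the two pins
by a bounded amount — a screening estimate in the class of Brydges–Federbush (1980) / Imbrie (1983) (jellium) / the
Federbush–Kennedy (1985) «surface effects» `r⁻³` law; expected value `κ(β,ρ) − β/|x−y|_T + o(1)` (memo §135(b); MC:
`KL(r) = κ − w(r) ± 0.002`, kit j302941).
[conjecture: theory seat hubbard-h0-rotor-theory-1, cycle 9, 2026-08-28 — memo ROTOR-THEORY-9 §135 (R8; OPEN); technique sources doi:10.1007/bf01197700, doi:10.1007/bf01208264, doi:10.1007/bf01209293] -/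
def JelliumSheetEntropyBound (β c : ℝ) : Prop :=
  ∃ C : ℝ, ∀ L : ℕ, ∀ [NeZero L], ∀ x y : TorusSite 2 L, x ≠ y →
    klDiv (teleLaw (jastrowAmp (sheetKernel L β c)) x y) (teleLaw (jastrowAmp (sheetKernel L β c)) y x) ≤ C

/-- **R8 ⟺ SCREENING.**  `JelliumSheetEntropyBound β c` is exactly the statement that the mean spectator potential
difference between a pinned vacancy and a pinned particle, in the classical sheet gas `|ψ|²`, is bounded uniformly (PROVED
equivalence). Theory seat memo ROTOR-THEORY-9 §135. [folklore] -/
theorem jelliumSheetEntropyBound_iff (β c : ℝ) :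
    JelliumSheetEntropyBound β c ↔
      ∃ C : ℝ, ∀ L : ℕ, ∀ [NeZero L], ∀ x y : TorusSite 2 L, x ≠ y →
        ∑ τ, teleLaw (jastrowAmp (sheetKernel L β c)) x y τ *
            (spectatorField (sheetKernel L β c) τ y - spectatorField (sheetKernel L β c) τ x) ≤ C := by
  unfold JelliumSheetEntropyBound
  constructor
  · rintro ⟨C, h⟩
    exact ⟨C, fun L _ x y hxy => by rw [← klDiv_teleLaw_sheet']; exact h L x y hxy⟩
  · rintro ⟨C, h⟩
    exact ⟨C, fun L _ x y hxy => by rw [klDiv_teleLaw_sheet']; exact h L x y hxy⟩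

/-- The sheet kernel is the difference kernel of `sheetFun`. [folklore] -/
theorem sheetKernel_eq_sheetFun (L : ℕ) [NeZero L] (β c : ℝ) (u v : TorusSite 2 L) :
    sheetKernel L β c u v = sheetFun L β c (u - v) := by
  unfold sheetKernel sheetFun
  simp only [sub_eq_zero]

/-- `sheetFun` is even. [folklore] -/
theorem sheetFun_neg (L : ℕ) [NeZero L] (β c : ℝ) (v : TorusSite 2 L) :
    sheetFun L β c (-v) = sheetFun L β c v := by
  unfold sheetFun
  simp only [neg_eq_zero, torusNorm_neg]

/-- Function form of `sheetKernel_eq_sheetFun`. [folklore] -/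
theorem sheetKernel_eq_fun (L : ℕ) [NeZero L] (β c : ℝ) :
    sheetKernel L β c = fun u v => sheetFun L β c (u - v) := by
  funext u v; exact sheetKernel_eq_sheetFun L β c u v

/-- **J3′ for the sheet.** `KL = Σ_z (condOcc(z) − m)(W(z−y) − W(z−x))` for every background constant `m`.
Theory seat memo ROTOR-THEORY-9 §135. [folklore] -/
theorem klDiv_teleLaw_sheet_cloud (L : ℕ) [NeZero L] (β c : ℝ) (x y : TorusSite 2 L) (m : ℝ) :
    klDiv (teleLaw (jastrowAmp (sheetKernel L β c)) x y) (teleLaw (jastrowAmp (sheetKernel L β c)) y x)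
      = ∑ z, (condOcc (jastrowAmp (sheetKernel L β c)) x y z - m)
          * (sheetFun L β c (z - y) - sheetFun L β c (z - x)) := by
  have hm := pairMass_symm_sheet L β c x y
  rw [sheetKernel_eq_fun] at hm ⊢
  exact klDiv_teleLaw_jastrow_cloud (sheetFun L β c) (sheetFun_neg L β c) x y hm m

/-- **R8a — `SheetWeightedScreening` (WEIGHTED TWO-DEFECT SCREENING;** classical statistical mechanics of the lattice
`1/r` sheet gas): the screening cloud `condOcc − m` of the conditioned pair «particle at x, vacancy at y» has bounded
`(|W(·−y)| + |W(·−x)|)`-weighted `ℓ¹` mass, uniformly in `L` and in the separation.  Debye–Hückel predicts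
`|condOcc(z) − ρ| ≲ dist(z,{x,y})^{−3}`, which gives this with room to spare.
[conjecture: theory seat hubbard-h0-rotor-theory-1, cycle 9, 2026-08-28 — memo ROTOR-THEORY-9 §135 (R8a; OPEN)] -/
def SheetWeightedScreening (β c : ℝ) : Prop :=
  ∃ C : ℝ, ∀ L : ℕ, ∀ [NeZero L], ∀ x y : TorusSite 2 L, x ≠ y → ∃ m : ℝ,
    ∑ z, |condOcc (jastrowAmp (sheetKernel L β c)) x y z - m|
        * (|sheetFun L β c (z - y)| + |sheetFun L β c (z - x)|) ≤ C

/-- **R8 ⟸ R8a (PROVED).**  Weighted screening of the two-defect cloud implies the jellium-sheet entropy bound.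
Theory seat memo ROTOR-THEORY-9 §135. [folklore] -/
theorem jelliumSheetEntropyBound_of_weightedScreening (β c : ℝ) :
    SheetWeightedScreening β c → JelliumSheetEntropyBound β c := by
  rintro ⟨C, h⟩
  refine ⟨C, fun L _ x y hxy => ?_⟩
  obtain ⟨m, hm⟩ := h L x y hxy
  rw [klDiv_teleLaw_sheet_cloud L β c x y m]
  refine le_trans (Finset.sum_le_sum fun z _ => ?_) hm
  calc (condOcc (jastrowAmp (sheetKernel L β c)) x y z - m)
          * (sheetFun L β c (z - y) - sheetFun L β c (z - x))
        ≤ |(condOcc (jastrowAmp (sheetKernel L β c)) x y z - m)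
          * (sheetFun L β c (z - y) - sheetFun L β c (z - x))| := le_abs_self _
    _ = |condOcc (jastrowAmp (sheetKernel L β c)) x y z - m|
          * |sheetFun L β c (z - y) - sheetFun L β c (z - x)| := abs_mul _ _
    _ ≤ |condOcc (jastrowAmp (sheetKernel L β c)) x y z - m|
          * (|sheetFun L β c (z - y)| + |sheetFun L β c (z - x)|) :=
        mul_le_mul_of_nonneg_left (abs_sub _ _) (abs_nonneg _)

end JelliumSheet

end Summit.HubbardSuperconductivity.HubbardSuperconductivity.Theorems.AnisotropyChord.InsertionEntropy
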